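import Summits.BirchSwinnertonDyer.BirchSwinnertonDyer.Theorems.ErratumRoadFiveIMCDivRoadFFFittingCutB
import Summits.BirchSwinnertonDyer.Rank1Residual.X11b.RouteR1ControlCastella
import Summits.BirchSwinnertonDyer.Rank1Residual.X11b.BDPRouteErratumData
import Summits.BirchSwinnertonDyer.Rank1Residual.X11b.BDPRouteSurj
import Summits.BirchSwinnertonDyer.Rank1Residual.Partition.IrreducibleOverQuadraticField
import Literature.NumberTheory.EllipticCurves.SigmaEulerData
import Summits.BirchSwinnertonDyer.Rank1Residual.Additive.CyclotomicPrimeMultiplicativeReduction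
import Summits.BirchSwinnertonDyer.Rank1Residual.Additive.QuadraticFieldCriterionThree
import HarnessLib

/-!
# Route `ErratumRoadFive` (rung K2, `p ≥ 5`), crux `IMCDivAtErratumDataAllR` (item stmt-BirchSwinnertonDyer-20169): the
# `Σ`-DATA STUB from the CORRECTED F7 fact (`…_of_noTamagawaDefect`) — the no-defect residual «every split multiplicative
# place of `E/K` in `Σ` has degree one over `ℚ`» DISCHARGED at erratum data

Cell `bsd-stepL` (run/shared/lean/pub/bsd-stepL/), seat `bsd-stepL-imc-p1` (prover g9, 2026-08-27); `--supports
stmt-BirchSwinnertonDyer-20169 --as helper`; Theses-free. MIGRATION (defn-ty1 g2, memo `F7-CORRECTION-defn-ty1-g2.md`,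
evidence #38 on 19270; STATUS 05:05:42Z «do NOT bind `prop332_charIdeal_XAc_sigma_change` in new statements»): the F7 fact
as first typed is FALSE on the Tamagawa-defect locus (a `Σ`-place totally split in `K_∞^{ac}` — `κ(φ_w) = 0` — where `E/K_w` is
SPLIT multiplicative); the corrected fact `prop332_charIdeal_XAc_sigma_change_of_noTamagawaDefect` carries the extra binder
`NoTamagawaDefect`, discharged by defn-ty1's `sigmaData_of_prop332_of_splitMult_imp_degree_one` down to
`hS : ∀ w ∈ Σ, (W.baseChange K).HasSplitMultiplicativeReductionAt w → e(w|ℚ) = 1 ∧ f(w|ℚ) = 1`. This file proves `hS` AT AN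
ERRATUM DATUM and re-derives this seat's `Σ`-data theorems (p496369, which bind the old fact and are hereby superseded —
kept in the tree as correct-but-vacuous implications):

* §1 **`P2.RoadFF.splitMult_sigmaPlaces_degreeOne_of_isErratumField`** — for an erratum field `K` of `(W, q)` (every
  `ℓ ∣ N`, `ℓ ≠ q`, SPLIT in `K`; `q ∣ d_K`) with `E/ℚ_q` NON-split multiplicative: a place `w ∈ Σ(W, p)(K)` at which
  `E/K` is split multiplicative has degree one. Proof: the rational prime `ℓ` under `w` divides `N` (`ℓ ∈ w ∋ N`, Bezout);
  if `ℓ ≠ q` it splits in `K`, so `e = f = 1` (`degreeOne_of_splitsIn`); if `ℓ = q` then `N(w) = q`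
  (`Additive.absNorm_eq_of_quadratic_of_dvd_discr`: `q ∣ d_K`, `[K:ℚ] = 2`) and non-split STAYS non-split at a place of
  residue degree one (`Additive.not_hasSplitMultiplicativeReductionAt_baseChange_of_not_split_prime`, the node-tangent quadratic
  over `k_w = 𝔽_q`) — contradiction.
* §2 `P2.RoadFF.sigmaDataAt_of_prop332_of_noTamagawaDefect_of_isErratumField` (one erratum field, ANY slot `v ∋ p`) and
  **`P2.RoadFF.sigmaDataAtErratumDataB_of_prop332_of_noTamagawaDefect`** : the corrected fact → GZK → modularity →
  `P2.RoadFF.SigmaDataAtErratumDataB W p Σ(·) P_Σ(·)` (+ the A-slot twin) — the `Σ`-stub of skeleton v4-B on the CORRECTED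
  binder; @plan: re-register `stub_roadFF_pubInputs` with `prop332_charIdeal_XAc_sigma_change_of_noTamagawaDefect`.

HONEST FRAMING: theorems only; CONDITIONAL on the three named PUBLISHED facts (JSW17 Prop. 3.3.2 as corrected, Gross–Zagier–
Kolyvagin, modularity); nothing is booked; BSD is proved for no pair; no count moves (T7).

References: [JetchevSkinnerWan2017] Prop. 3.3.2, Thm. 3.3.1, proof of Thm. 6.1.6; [Castella2018] Thm. 2.3 (2.7), Prop. 2.5
(arXiv:1704.06608 p. 7); [Brink2007] Thm. 2; [SilvermanAEC2009] VII.5 Prop. 5.1(b), VII.1 Prop. 1.3(b); [Castella2018Erratum]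
proof of Thm. 1.1 (p. 4); F7-CORRECTION memo (defn-ty1 g2).
-/

set_option autoImplicit false

noncomputable section

open scoped Classical

open WeierstrassCurve NumberField IsDedekindDomain Field PowerSeries
open Literature.NumberTheory.EllipticCurves Literature.NumberTheory.EllipticCurves.GreenbergSelmer
  Literature.NumberTheory.EllipticCurves.ModularForms Literature.NumberTheory.EllipticCurves.Rank1Residual
  Literature.NumberTheory.EllipticCurves.Rank1Residual.Typed Literature.NumberTheory.EllipticCurves.Castella2018
  Literature.NumberTheory.EllipticCurves.JetchevSkinnerWan2017 Literature.NumberTheory.GaloisRepresentations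
  Literature.NumberTheory.GaloisCohomology
open Summit.BirchSwinnertonDyer.Rank1Residual.X11b.AcSelmer Summit.BirchSwinnertonDyer.Rank1Residual.X11b.Halves
open Summit.BirchSwinnertonDyer.Rank1Residual

namespace Summit.BirchSwinnertonDyer.Rank1Residual.X11b

/-! ### §1 The no-defect residual at an erratum field -/

section NoDefect

variable (W : WeierstrassCurve ℚ) [W.IsElliptic] [W.IsGloballyMinimal] (p : ℕ) [Fact p.Prime]
  {K : Type} [Field K] [NumberField K]

omit [W.IsGloballyMinimal] [Fact (Nat.Prime p)] in
/-- The rational prime under a place `w ∈ Σ(W, p)(K)`: some prime `ℓ ∣ N`, `ℓ ≠ p`, lies in `w` (the generator `ℓ` of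
`w ∩ ℤ` lies in `w ∋ N`, and `ℓ ∤ N` would put `1 = aℓ + bN` in `w`). [folklore] -/
theorem exists_prime_mem_of_mem_sigmaPlacesFinset {w : HeightOneSpectrum (𝓞 K)}
    (hw : w ∈ W.sigmaPlacesFinset p K) :
    ∃ ℓ : ℕ, ℓ.Prime ∧ ℓ ∣ W.conductorNorm ℤ ∧ ℓ ≠ p ∧ ((ℓ : ℕ) : 𝓞 K) ∈ w.asIdeal := by
  rw [WeierstrassCurve.mem_sigmaPlacesFinset_iff, WeierstrassCurve.mem_sigmaPlaces_iff] at hw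
  obtain ⟨hN, hp⟩ := hw
  set u : HeightOneSpectrum (𝓞 ℚ) := w.under (𝓞 ℚ) with hu
  set ℓ : ℕ := ((Rat.HeightOneSpectrum.primesEquiv u : Nat.Primes) : ℕ) with hℓ
  have hℓprime : ℓ.Prime := (Rat.HeightOneSpectrum.primesEquiv u).2
  have hℓw : ((ℓ : ℕ) : 𝓞 K) ∈ w.asIdeal := by
    have h := (Rat.HeightOneSpectrum.natGenerator_dvd_iff u).mp dvd_rfl
    rw [← map_natCast (Rat.IsIntegralClosure.intEquiv (𝓞 ℚ)), Ideal.apply_mem_of_equiv_iff] at h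
    rw [hu, HeightOneSpectrum.under_asIdeal, Ideal.under_def, Ideal.mem_comap, map_natCast] at h
    exact h
  refine ⟨ℓ, hℓprime, ?_, fun h ↦ hp (h ▸ hℓw), hℓw⟩
  by_contra hndvd
  have hcop : IsCoprime (ℓ : ℤ) (W.conductorNorm ℤ : ℤ) :=
    Nat.isCoprime_iff_coprime.mpr ((Nat.Prime.coprime_iff_not_dvd hℓprime).mpr hndvd)
  obtain ⟨a, b, hab⟩ := hcop
  apply w.isPrime.ne_top
  rw [Ideal.eq_top_iff_one]
  have h1 : ((a * ℓ + b * (W.conductorNorm ℤ : ℤ) : ℤ) : 𝓞 K) = 1 := by rw [hab, Int.cast_one]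
  rw [← h1]
  push_cast
  exact w.asIdeal.add_mem (w.asIdeal.mul_mem_left _ (by exact_mod_cast hℓw))
    (w.asIdeal.mul_mem_left _ (by exact_mod_cast hN))

omit [Fact (Nat.Prime p)] in
/-- **The no-defect residual HOLDS at an erratum field**: for `K` an erratum field of `(W, q)` (`[K:ℚ] = 2`, `q ∣ d_K`, every
prime `ℓ ∣ N` other than `q` split in `K`) and `E/ℚ_q` NON-split multiplicative, every place `w ∈ Σ(W, p)(K)` at which `E/K`
has SPLIT multiplicative reduction has `e(w|ℚ) = f(w|ℚ) = 1`. At `w ∣ q`: `N(w) = q` and non-split stays non-split at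
residue degree one, so the hypothesis is void; at `w ∣ ℓ ≠ q`: `ℓ` splits. This is defn-ty1's binder `hS` of
`sigmaData_of_prop332_of_splitMult_imp_degree_one`. [cite: SilvermanAEC2009, VII.5 Prop. 5.1(b) and VII.1 Prop. 1.3(b)]
[cite: Castella2018, §5 (arXiv:1704.06608 p. 12, the choice of `K`)] -/
theorem P2.RoadFF.splitMult_sigmaPlaces_degreeOne_of_isErratumField {q : ℕ} [Fact q.Prime]
    (hmq : Mult W q) (hnsq : ¬ W.HasSplitMultiplicativeReductionAtPrime q) (hK : IsErratumField W K q) :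
    ∀ w ∈ W.sigmaPlacesFinset p K, (W.baseChange K).HasSplitMultiplicativeReductionAt w →
      w.asIdeal.ramificationIdx (𝓞 ℚ) = 1 ∧ w.asIdeal.inertiaDeg (𝓞 ℚ) = 1 := by
  intro w hw hsplit
  obtain ⟨ℓ, hℓ, hℓN, -, hℓw⟩ := exists_prime_mem_of_mem_sigmaPlacesFinset W p hw
  by_cases hℓq : ℓ = q
  · subst hℓq
    exfalso
    have hNw : Ideal.absNorm w.asIdeal = ℓ :=
      Additive.absNorm_eq_of_quadratic_of_dvd_discr ℓ K w hK.1.1 hK.2.1 hℓw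
    exact Additive.not_hasSplitMultiplicativeReductionAt_baseChange_of_not_split_prime W ℓ w hℓw hNw hmq
      hnsq hsplit
  · haveI : Fact ℓ.Prime := ⟨hℓ⟩
    exact degreeOne_of_splitsIn hK.1.1 (hK.2.2.1 ℓ hℓ hℓN hℓq) hℓw

end NoDefect

/-! ### §2 The `Σ`-data from the corrected fact -/

section SigmaData

variable (W : WeierstrassCurve ℚ) [W.IsElliptic] [W.IsGloballyMinimal] (p : ℕ) [Fact p.Prime]
  {K : Type} [Field K] [NumberField K]

/-- **`Σ`-data at an erratum field, ANY X-slot `v ∋ p`, from the CORRECTED JSW17 Prop. 3.3.2.** Hypotheses as in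
`P2.RoadFF.sigmaDataAt_of_prop332_of_isErratumField` (p496369) plus `E/ℚ_q` non-split multiplicative (the erratum datum's
witness clause), with the fact binder now `prop332_charIdeal_XAc_sigma_change_of_noTamagawaDefect`; the no-defect
residual is §1. CONDITIONAL on `h332`, `hGZK`, `hnf`. [cite: JetchevSkinnerWan2017, Prop. 3.3.2 with Thm. 3.3.1 (arXiv:1512.06894 §3.3)]
[cite: Castella2018, Thm. 2.3 (2.7) and Prop. 2.5 (arXiv:1704.06608 p. 7)] -/
theorem P2.RoadFF.sigmaDataAt_of_prop332_of_noTamagawaDefect_of_isErratumField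
    (h332 : prop332_charIdeal_XAc_sigma_change_of_noTamagawaDefect)
    (hGZK : rank_eq_analyticRank_of_analyticRank_le_one) (hnf : exists_isNewformOf)
    (hE : ErratumHypotheses W p) (hr : W.analyticRank = 1) {q : ℕ} [Fact q.Prime] (hqp : q ≠ p)
    (hmq : Mult W q) (hnsq : ¬ W.HasSplitMultiplicativeReductionAtPrime q)
    (hvq : ¬ p ∣ padicValInt q W.minimalDiscriminantInt) (hK : IsErratumField W K q)
    (κ : ZpExtension K p) (hκ : κ.IsAnticyclotomic) (γ : Field.absoluteGaloisGroup K)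
    [Fact (κ.IsTopGenerator γ)] (v : HeightOneSpectrum (𝓞 K)) (hv : ((p : ℕ) : 𝓞 K) ∈ v.asIdeal) :
    P2.RoadFF.SigmaDataAt W p κ v γ (↑(W.sigmaPlacesFinset p K) : Set (HeightOneSpectrum (𝓞 K)))
      (W.sigmaEulerElement p K κ) := by
  have hp3 : 3 < p := lt_of_lt_of_le (by norm_num) hE.1
  have hmult : Mult W p := hE.2.1
  have hsurj : Surj W p := surj_of_irr_of_ram W p hE.2.2.1 ⟨q, ‹_›, hqp, hmq, hvq⟩
  have hirrK : (W.baseChange K).HasIrreducibleModPGaloisRep p := irrK_of_surj W p hsurj K hK.1.1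
  have hsp : SplitsIn K p := hK.splitsIn_of_mult hmult (Ne.symm hqp)
  have hHp : SatisfiesHeegnerHypothesis p K := satisfiesHeegnerHypothesis_of_splitsIn Fact.out hsp
  obtain ⟨hrank, hSha⟩ := IsErratumField.mordellWeilRank_eq_one_and_shaFinite W hGZK hnf hr hK
  haveI : Finite (W.baseChange K).sha := hSha
  have hShap : Finite (AddCommGroup.primaryComponent (W.baseChange K).sha p) :=
    Finite.of_injective _ Subtype.val_injective
  obtain ⟨he, hf⟩ := degreeOne_of_splitsIn hK.1.1 hsp hv
  exact sigmaData_of_prop332_of_splitMult_imp_degree_one h332 W p hp3 (Or.inr hmult) K hK.1 hHp hirrK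
    (embAt K p v hv he hf) v (mem_asIdeal_iff_norm_embAt_lt_one v hv he hf) κ hκ γ hrank hShap
    (P2.RoadFF.splitMult_sigmaPlaces_degreeOne_of_isErratumField W p hmq hnsq hK)

/-- **THE `Σ`-STUB OF SKELETON v4-B ON THE CORRECTED BINDER**: `P2.RoadFF.SigmaDataAtErratumDataB W p Σ(·) P_Σ(·)` at every
erratum datum and every X-slot `𝔭bar`, from `prop332_charIdeal_XAc_sigma_change_of_noTamagawaDefect` + GZK + modularity
(the erratum datum supplies the non-split clause at `q`). Supersedes p496369's `…_of_prop332`. CONDITIONAL on the three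
named facts; nothing booked. [cite: JetchevSkinnerWan2017, Prop. 3.3.2 with Thm. 3.3.1 (arXiv:1512.06894 §3.3)]
[cite: Castella2018Erratum, proof of Thm. 1.1 (p. 4)] -/
theorem P2.RoadFF.sigmaDataAtErratumDataB_of_prop332_of_noTamagawaDefect
    (h332 : prop332_charIdeal_XAc_sigma_change_of_noTamagawaDefect)
    (hGZK : rank_eq_analyticRank_of_analyticRank_le_one) (hnf : exists_isNewformOf) :
    P2.RoadFF.SigmaDataAtErratumDataB W p
      (fun K _ _ ↦ (↑(W.sigmaPlacesFinset p K) : Set (HeightOneSpectrum (𝓞 K))))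
      (fun K _ _ κ _ ↦ W.sigmaEulerElement p K κ) := by
  intro _ q _ K _ _ Dt H w₀ P hE hr hqp hmq hns hvq hK hCas hP hc hinf κ hκ γ _ ι' e he 𝔭bar h𝔭bar _
  exact P2.RoadFF.sigmaDataAt_of_prop332_of_noTamagawaDefect_of_isErratumField W p h332 hGZK hnf hE hr
    hqp hmq hns hvq hK κ hκ γ 𝔭bar h𝔭bar

/-- **The A-slot twin on the corrected binder** (X-slot = the datum's prime `𝔭_{ι'}`). CONDITIONAL; nothing booked.
[cite: JetchevSkinnerWan2017, Prop. 3.3.2 with Thm. 3.3.1 (arXiv:1512.06894 §3.3)] -/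
theorem P2.RoadFF.sigmaDataAtErratumData_of_prop332_of_noTamagawaDefect
    (h332 : prop332_charIdeal_XAc_sigma_change_of_noTamagawaDefect)
    (hGZK : rank_eq_analyticRank_of_analyticRank_le_one) (hnf : exists_isNewformOf) :
    P2.RoadFF.SigmaDataAtErratumData W p
      (fun K _ _ ↦ (↑(W.sigmaPlacesFinset p K) : Set (HeightOneSpectrum (𝓞 K))))
      (fun K _ _ κ _ ↦ W.sigmaEulerElement p K κ) := by
  intro _ q _ K _ _ Dt H w₀ P hE hr hqp hmq hns hvq hK hCas hP hc hinf κ hκ γ _ ι' e he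
  exact P2.RoadFF.sigmaDataAt_of_prop332_of_noTamagawaDefect_of_isErratumField W p h332 hGZK hnf hE hr
    hqp hmq hns hvq hK κ hκ γ _ (natCast_mem_primeOfEmbeddingDatum p ι' w₀.embedding)

end SigmaData

end Summit.BirchSwinnertonDyer.Rank1Residual.X11b

end
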